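import Mathlib
import Summits.ResolutionOfSingularities.ResolutionOfSingularities.Theorems.SyzygyFlatteningDefs
import Literature.AlgebraicGeometry.Resolution.SyzygySheaf
import Literature.AlgebraicGeometry.Resolution.ModuleBlowup
import HarnessLib

/-!
# Every noetherian stage has a minimal chart datum

Crux `HigherRankTermination` (stmt-ResolutionOfSingularities-17045), line `birth`, stub
`stub_exists_minimalDatum`: for a noetherian `k`-subalgebra `B ⊆ O` of `K` (`O` a valuation
ring of the field `K`) the data quantified over in `chartSet O B` exist: a free resolution of
finite type `(b, d, ε)` of `B ⧸ singIdeal B`, an injective `B`-linear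
`ι : range (d (n - 1)) → B^r` (`n = syzygyIndex k K`) with torsion cokernel, and an `r`-tuple
`x` of syzygies with `det (ι x) ≠ 0` in `K` and `det (ι g') * (det (ι x))⁻¹ ∈ O` for every
`r`-tuple `g'` (an `O`-minimal maximal minor).

Proof (every ingredient is in the tree; the statement is proved for an arbitrary noetherian
domain `A → K` and then specialised to `A = B`).
* `FreeResolution.ofNoetherian` (`SyzygySheaf.lean`): a finite module over a noetherian ring has
  a free resolution of finite type; `B ⧸ singIdeal B` is cyclic, hence finite, over `B`.
* The syzygy module `M = range (d m) ⊆ A^{b m}` is finite (image of a finite free module), so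
  its generic rank is a natural number `r = finrank M` (`Module.finrank_eq_rank`; a domain
  satisfies the strong rank condition).
* `exists_isFraming` (`ModuleBlowup.lean`): a finite module of generic rank `r` over a domain
  has a framing `φ : M → A^r` (kernel and cokernel torsion). `M` sits in the torsion-free module
  `A^{b m}`, so "kernel torsion" upgrades to "injective"
  (`eq_zero_of_smul_eq_zero_of_mem_nonZeroDivisors`).
* `IsFraming.exists_det_div_mem` (`ModuleBlowup.lean`): some `r`-tuple `x` has `det (φ x) ≠ 0`
  of minimal `O`-value, `det (φ g) / det (φ x) ∈ O` for all `g`; and the determinant of the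
  matrix of images in `K` is the image of `det (frameMatrix φ g)` (`RingHom.map_det`).
-/

noncomputable section

-- single-problem summit: the doubled namespace component `ResolutionOfSingularities` is forced
set_option linter.dupNamespace false

namespace Summit.ResolutionOfSingularities.ResolutionOfSingularities.Theorems.SyzygyFlattening

open Literature.AlgebraicGeometry.Resolution

/-- The determinant of the matrix of images `(algebraMap A K (φ (g i) j))ᵢⱼ` is the image in `K`
of the determinant of the frame matrix `frameMatrix φ g = (φ (g i) j)ᵢⱼ`. [folklore] -/
theorem det_of_algebraMap_frame_eq {A : Type*} [CommRing A] {K : Type*} [CommRing K]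
    [Algebra A K] {M : Type*} [AddCommGroup M] [Module A M] {r : ℕ}
    (φ : M →ₗ[A] (Fin r → A)) (g : Fin r → M) :
    Matrix.det (Matrix.of fun i j => algebraMap A K (φ (g i) j)) =
      algebraMap A K (frameMatrix φ g).det := by
  have h : (Matrix.of fun i j => algebraMap A K (φ (g i) j)) =
      (algebraMap A K).mapMatrix (frameMatrix φ g) := by
    ext i j
    rfl
  rw [h, ← RingHom.map_det]

/-- A framing of a submodule `M` of a finite free module `A^m` is injective: its kernel is
killed by non-zero-divisors, and non-zero-divisors kill nothing in `A^m`. [folklore] -/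
theorem injective_of_isFraming_submodule_pi {A : Type*} [CommRing A] {m r : ℕ}
    (M : Submodule A (Fin m → A)) {φ : ↥M →ₗ[A] (Fin r → A)} (hφ : IsFraming φ) :
    Function.Injective φ := by
  rw [injective_iff_map_eq_zero]
  intro v hv
  obtain ⟨a, ha, hav⟩ := hφ.exists_smul_eq_zero v hv
  have h : a • (v : Fin m → A) = 0 := by
    rw [← Submodule.coe_smul, hav, Submodule.coe_zero]
  exact (Submodule.coe_eq_zero).mp (eq_zero_of_smul_eq_zero_of_mem_nonZeroDivisors ha h)

/-- Over a nontrivial ring the cokernel of a framing is torsion in the route's form: every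
`z ∈ A^r` has a NONZERO multiple in the image (non-zero-divisors are nonzero). [folklore] -/
theorem exists_ne_zero_smul_mem_range_of_isFraming {A : Type*} [CommRing A] [Nontrivial A]
    {M : Type*} [AddCommGroup M] [Module A M] {r : ℕ} {φ : M →ₗ[A] (Fin r → A)}
    (hφ : IsFraming φ) (z : Fin r → A) : ∃ a : A, a ≠ 0 ∧ a • z ∈ LinearMap.range φ := by
  obtain ⟨a, ha, haz⟩ := hφ.exists_smul_mem z
  exact ⟨a, nonZeroDivisors.ne_zero ha, haz⟩

/-- **Minimal chart data exist over a noetherian domain.** Let `A` be a noetherian domain,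
`A → K` an injective algebra map into a field with image in the valuation ring `O`, `N` a finite
`A`-module and `m : ℕ`. Then there are a free resolution of finite type `(b, d, ε)` of `N`, an
injective `ι : range (d m) → A^r` with torsion cokernel, and an `r`-tuple `x` of elements of
`range (d m)` with `det (ι x) ≠ 0` in `K` and `det (ι g') * (det (ι x))⁻¹ ∈ O` for every
`r`-tuple `g'` — the chart of the blow-up of the ideal of maximal minors selected by `O`.
[cite: NovacoskiSpivakovsky2014, Def. 2.11] -/
theorem exists_minimalDatum_of_isNoetherianRing {A : Type*} [CommRing A] [IsDomain A]
    [IsNoetherianRing A] {K : Type*} [Field K] [Algebra A K] (O : ValuationSubring K)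
    (hinj : Function.Injective (algebraMap A K)) (hAO : ∀ a : A, algebraMap A K a ∈ O)
    (N : Type*) [AddCommGroup N] [Module A N] [Module.Finite A N] (m : ℕ) :
    ∃ (b : ℕ → ℕ) (d : (i : ℕ) → ((Fin (b (i + 1)) → A) →ₗ[A] (Fin (b i) → A)))
      (ε : (Fin (b 0) → A) →ₗ[A] N) (r : ℕ) (ι : ↥(LinearMap.range (d m)) →ₗ[A] (Fin r → A)),
      Function.Surjective ε ∧ Function.Exact (d 0) ε ∧
        (∀ i : ℕ, Function.Exact (d (i + 1)) (d i)) ∧ Function.Injective ι ∧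
        (∀ z : Fin r → A, ∃ a : A, a ≠ 0 ∧ a • z ∈ LinearMap.range ι) ∧
        ∃ x : Fin r → ↥(LinearMap.range (d m)),
          Matrix.det (Matrix.of fun i j => algebraMap A K (ι (x i) j)) ≠ 0 ∧
          ∀ g' : Fin r → ↥(LinearMap.range (d m)),
            Matrix.det (Matrix.of fun i j => algebraMap A K (ι (g' i) j)) *
              (Matrix.det (Matrix.of fun i j => algebraMap A K (ι (x i) j)))⁻¹ ∈ O := by
  obtain ⟨b, d, ε, hε, h0, hs⟩ := FreeResolution.ofNoetherian (R := A) N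
  -- the generic rank of the (finite) syzygy module `range (d m)` is a natural number `r`
  obtain ⟨r, hr⟩ : ∃ r : ℕ, Module.rank A ↥(LinearMap.range (d m)) = r :=
    ⟨_, (Module.finrank_eq_rank A _).symm⟩
  -- a framing of the syzygy module and an `O`-minimal maximal minor
  obtain ⟨φ, hφ⟩ := exists_isFraming hr
  obtain ⟨x, hx0, hmin⟩ := hφ.exists_det_div_mem O hinj hAO
  refine ⟨b, d, ε, r, φ, hε, h0, hs, injective_of_isFraming_submodule_pi _ hφ,
    exists_ne_zero_smul_mem_range_of_isFraming hφ, x, ?_, fun g' => ?_⟩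
  · rw [det_of_algebraMap_frame_eq φ x]
    exact hx0
  · rw [det_of_algebraMap_frame_eq φ g', det_of_algebraMap_frame_eq φ x, ← div_eq_mul_inv]
    exact hmin g'

/-- **Minimal chart data for a quotient ring `A ⧸ I`** (the case of the route: the resolved
module is `B ⧸ singIdeal B`): `exists_minimalDatum_of_isNoetherianRing` with `N = A ⧸ I`, so
that the `A`-module structure of the target of `ε` is the one of the statement of the stub.
[cite: NovacoskiSpivakovsky2014, Def. 2.11] -/
theorem exists_minimalDatum_quotient {A : Type*} [CommRing A] [IsDomain A]
    [IsNoetherianRing A] {K : Type*} [Field K] [Algebra A K] (O : ValuationSubring K)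
    (hinj : Function.Injective (algebraMap A K)) (hAO : ∀ a : A, algebraMap A K a ∈ O)
    (I : Ideal A) (m : ℕ) :
    ∃ (b : ℕ → ℕ) (d : (i : ℕ) → ((Fin (b (i + 1)) → A) →ₗ[A] (Fin (b i) → A)))
      (ε : (Fin (b 0) → A) →ₗ[A] (A ⧸ I)) (r : ℕ)
      (ι : ↥(LinearMap.range (d m)) →ₗ[A] (Fin r → A)),
      Function.Surjective ε ∧ Function.Exact (d 0) ε ∧
        (∀ i : ℕ, Function.Exact (d (i + 1)) (d i)) ∧ Function.Injective ι ∧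
        (∀ z : Fin r → A, ∃ a : A, a ≠ 0 ∧ a • z ∈ LinearMap.range ι) ∧
        ∃ x : Fin r → ↥(LinearMap.range (d m)),
          Matrix.det (Matrix.of fun i j => algebraMap A K (ι (x i) j)) ≠ 0 ∧
          ∀ g' : Fin r → ↥(LinearMap.range (d m)),
            Matrix.det (Matrix.of fun i j => algebraMap A K (ι (g' i) j)) *
              (Matrix.det (Matrix.of fun i j => algebraMap A K (ι (x i) j)))⁻¹ ∈ O :=
  exists_minimalDatum_of_isNoetherianRing O hinj hAO (A ⧸ I) m

/-- **Registered stub `stub_exists_minimalDatum`** (crux stmt-ResolutionOfSingularities-17045,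
line `birth`): a noetherian stage `B ⊆ O` with `Frac B = K` has a minimal chart datum — a free
resolution of finite type of `B ⧸ singIdeal B` (`FreeResolution.ofNoetherian`), an injective
embedding with torsion cokernel of its `n`-th syzygy module `range (d (n - 1))`,
`n = syzygyIndex k K`, into some `B^r` (`exists_isFraming` plus torsion-freeness of `B^{b _}`),
and an `r`-tuple `x` with `det (ι x) ≠ 0` of minimal `O`-value
(`IsFraming.exists_det_div_mem`). Specialisation of `exists_minimalDatum_quotient` to `A = B`,
`I = singIdeal B`, `algebraMap B K = Subtype.val`. [cite: NovacoskiSpivakovsky2014, Def. 2.11] -/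
theorem stub_exists_minimalDatum : ∀ (k K : Type) [Field k] [Field K] [Algebra k K]
    (O : ValuationSubring K) (B : Subalgebra k K), B.toSubring ≤ O.toSubring →
      IsNoetherianRing ↥B → IsFractionRing ↥B K →
      ∃ (b : ℕ → ℕ) (d : (i : ℕ) → ((Fin (b (i + 1)) → ↥B) →ₗ[↥B] (Fin (b i) → ↥B)))
        (ε : (Fin (b 0) → ↥B) →ₗ[↥B] (↥B ⧸ singIdeal B)) (r : ℕ)
        (ι : ↥(LinearMap.range (d (syzygyIndex k K - 1))) →ₗ[↥B] (Fin r → ↥B)),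
        Function.Surjective ε ∧ Function.Exact (d 0) ε ∧ (∀ i : ℕ, Function.Exact (d (i + 1)) (d i)) ∧
        Function.Injective ι ∧ (∀ z : Fin r → ↥B, ∃ a : ↥B, a ≠ 0 ∧ a • z ∈ LinearMap.range ι) ∧
        ∃ x : Fin r → ↥(LinearMap.range (d (syzygyIndex k K - 1))),
          Matrix.det (Matrix.of fun i j => ((ι (x i) j : ↥B) : K)) ≠ 0 ∧
          ∀ g' : Fin r → ↥(LinearMap.range (d (syzygyIndex k K - 1))),
            Matrix.det (Matrix.of fun i j => ((ι (g' i) j : ↥B) : K)) *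
              (Matrix.det (Matrix.of fun i j => ((ι (x i) j : ↥B) : K)))⁻¹ ∈ O := by
  intro k K _ _ _ O B hB hNoeth _hFrac
  haveI := hNoeth
  have hinj : Function.Injective (algebraMap ↥B K) := fun a a' h => Subtype.ext h
  have hAO : ∀ a : ↥B, algebraMap ↥B K a ∈ O := fun a => hB a.2
  exact exists_minimalDatum_quotient O hinj hAO (singIdeal B) (syzygyIndex k K - 1)

end Summit.ResolutionOfSingularities.ResolutionOfSingularities.Theorems.SyzygyFlattening

end
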